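/-
Copyright: lit-balaban Phase-2 proof seat p31 (gen 4).  Statement-level skeleton of a published paper; no proof claims beyond what the
kernel checks below.
-/
import Literature.MathematicalPhysics.QuantumFieldTheory.BalabanImbrieJaffe1984to88.BIJ88Eq210Torus
import Literature.MathematicalPhysics.QuantumFieldTheory.BalabanImbrieJaffe1984to88.BIJ85Eq213AdjointExplicit
import Literature.MathematicalPhysics.QuantumFieldTheory.BalabanImbrieJaffe1984to88.BIJ88RenormTransf311

/-!
# `BalabanImbrieJaffe1984to88.BIJ88Eq552CutoffWitness` — T. Bałaban, J. Imbrie, A. Jaffe, *Effective action and cluster properties of the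
abelian Higgs model*, Commun. Math. Phys. **114** (1988) 257–315 [BalabanImbrieJaffe1988]: the sentence after **(5.5.2)** (p. 284),
*"Our construction of a C^{(k)}_{loc} satisfying (2.10), (2.11) ensures that … δ(QA′) = δ(QA^{(k)})"*, examined ON THE TORUS OF RECORD —
a KERNEL WITNESS that with the cut-off `Λ₄^{(k)*}` placed OUTSIDE `C^{(k)}_{loc}` as printed in (5.5.2) the operator `QΛ*C_loc` does NOT
vanish (it is supported on the L-bonds straddling ∂Λ), and the one-line repair (cut-off INSIDE: `Q(C_locΛ*) = 0` by (2.10))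

statement-level skeleton of published theorems with citation tags; proofs where landed; nothing here is a claim about the Yang–Mills mass gap

PDF held: `paper:balaban1988-cmp114-bij-abelian-higgs-effective-action` (journal page = PDF page + 256); p. 283 [PDF 27] re-read AS AN IMAGE
this session (`HOME/lit-balaban-r16/renders/cmp114/original-p027-x2.png`: (5.5.2) carries `Λ₄^{(k)*}` as the OUTERMOST factor, both in the
"approximately equal" translation `Λ₄^{(k)*}L^{−2}C^{(k)}H*_k∂*Q^{e*}_{k+1}f` and in (5.5.2) itself); p. 284 [PDF 28] from the text layer
(`lit read … --pages 27-29`); p. 266 for `X*` = bonds with both endpoints in `X` (`BIJ88Sect3Statements`, r18, kernel remark PROVED there).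

CITATION HEADER (lean-in-tree rule).  Part of the lit-balaban TYPED SKELETON (HOME `run/shared/lean/pub/lit-balaban/`), Phase-2 seat p31
(gen 4, own lane = the torus block geometry); row **C2.Eq5.5.1-5.5.12**, member (5.5.2) (§5 fold owner r16, referee ref-5).  The typed
decl of record is r16's `BIJ88Sect5StatementsPart3.Q_transl552`, which proves `QA′ = QA^{(k)}` UNDER THE HYPOTHESIS `hQ : Q * Λ4 * Cloc = 0`;
this file shows that hypothesis is NOT a consequence of (2.10)–(2.11) for the printed (outer) position of `Λ₄^{(k)*}` — companion GAPS.md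
entry filed by this seat (owner r16 to rule / renumber).

THE PRINTED TEXT (verbatim).  p. 283 [PDF 27]: *"So we eliminate most of the linear term by a translation approximately equal to
Λ₄^{(k)*}L^{−2}C^{(k)}H*_k∂*Q^{e*}_{k+1}f. The translation we actually use is localized, and is given by A′ = A^{(k)} −
Λ₄^{(k)*}L^{−2}C^{(k)}_{loc}H*_{k,loc}∂*Q^{e*}_{k+1}f. (5.5.2)"*; p. 284 [PDF 28]: *"Our construction of a C^{(k)}_{loc} satisfying (2.10),
(2.11) ensures that δ_Ax(A′) = δ_Ax(A^{(k)}), δ(QA′) = δ(QA^{(k)})."*; (2.9)–(2.10) p. 261: *"C^{(k)}_{loc} = (I − Q^{s*}Q)C̃^{(k)}(I − Q*Q^s);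
(2.9) this insures that … QC^{(k)}_{loc} = C^{(k)}_{loc}Q* = 0, (2.10)"*; p. 266: `X*` = the bonds with both endpoints in `X`; (5.3.7)
p. 280: the constraint `δ_{Λ₁^{(k)′*}}((e_k/2π)QA′)` is imposed on the L-bonds of `Λ₁^{(k)′*} ⊃ Λ₄^{(k)}`-straddling ones.

WHAT IS SHOWN (kind «kernel witness», nothing asserted beyond it).  On the tori of `Balaban1983to89.Setup` (unit lattice `PBond P j`,
L-lattice `PBond P (j+1)`, standing range `j + 1 ≤ m + K`, `d ≥ 2`), with the CONCRETE Q = `BIJ85Eq213Adjoint.qKer` ((2.13) of [2]), Q* =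
`qstKer`, Q^s/Q^{s*} = `BIJ88Eq211Proof.qsKer`/`qsstKer`, C_loc = `BIJ88Eq211Proof.clocKer` ((2.9)), and for `Λ = ⋃_{y∈S} B(y)` ANY union of
L-blocks, `Λ*` = `cutStar S` (the 0/1 multiplication operator of the unit bonds with both endpoints in `Λ`):
(1) REPAIR / what (2.10) does give: `Q·(C_loc·Λ*) = 0` for every `C̃`, every `S` (`qKer_mul_clocKer_mul`) — the cut-off INSIDE is harmless;
(2) WITNESS: for every L-bond `c₀ = ⟨y, y + e₁⟩` LEAVING `Λ` (`y ∈ S`, `y + e₁ ∉ S`; such bonds exist for every non-empty proper `Λ`, e.g.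
`S = {y}`), take `C̃ = E_{b₀b₀}` the matrix unit at the interior bond `b₀ = ⟨x₀, x₀ + e₁⟩` of `B(y)`, `x₀` = the site of `B(y)` with offsets
`(1, 0, …, 0)`: `b₀` is NOT a bond of the axial tree of record `BIJ88RenormTransf311.axialBonds` (`not_isAxialBond_witnessBond`), so `C̃` has
range 0 and vanishing tree rows/columns — every structural property (2.8)–(2.11) ask of `C̃^{(k)}` — and its `C_loc` satisfies (2.10)
(`qKer_mul_clocKer`) and (2.11); YET **`(Q·Λ*·C_loc)(c₀, b₀) = L^{−(d+1)} ≠ 0`** (`cutoff_witness`, `qKer_mul_cutStar_mul_clocKer_ne_zero`;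
block-ring form `emb_witness_ne_zero`): the column `C_loc(·, b₀) = δ_{b₀} − Q^{s*}Q δ_{b₀}` is corrected on the surface bonds of `c₀` and of
`⟨y − e₁, y⟩` only, the cut-off deletes the correction on `B^s(c₀)` (one endpoint outside `Λ`), and the straight contours (2.13) of `c₀` then
see the bare `δ_{b₀}` with multiplicity `s₁ + 1 = 1` (`BIJ85Eq213AdjointExplicit.runCount_blockSite`).  Hence `δ(QA′) = δ(QA^{(k)})` does not
follow from (2.10)–(2.11) for the translation (5.5.2) as printed: `Q(A^{(k)} − A′)` is supported on the L-bonds straddling `∂Λ₄^{(k)}`, which lie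
in `Λ₁^{(k)′*}` where (5.3.7) imposes the constraint.  HONEST SCOPE: a located imprecision with an evident repair (1) (or: the translation
is meant with the cut-off inside / the straddling shift is carried along); which one the authors intend is for the §5 owner to rule; no
claim about the remainder of Sect. 5.  Unit `lit-balaban-p31` (literature-prover-lit-balaban-p31-g4-0), 2026-08-21.
-/

open scoped BigOperators

namespace Literature.MathematicalPhysics.QuantumFieldTheory.BalabanImbrieJaffe1984to88.BIJ88Eq552CutoffWitness

open Literature.MathematicalPhysics.QuantumFieldTheory.Balaban1983to89
open BIJ85Sect2SurfaceAverages LatticeFieldCalculus BIJ85Eq219Proof BIJ85Eq213Adjoint BIJ85Eq213AdjointExplicit BIJ88Eq211Proof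
  BIJ88Eq210Torus BIJ88RenormTransf311

variable {P : Params} {j : ℕ}

/-! ## 1. The cut-off `Λ*` of a union of blocks, and the repair -/

open Classical in
/-- The cut-off of (5.5.2) for a union of L-blocks `Λ = ⋃_{y∈S} B(y)`: the multiplication operator by the indicator of
`Λ* = {b : both endpoints of b in Λ}` (p. 266) on unit-lattice bond functions, as a diagonal matrix. [cite: BalabanImbrieJaffe1988, (5.5.2) p.283] -/
noncomputable def cutStar (S : Finset (Balaban1983to89.Site P (j + 1))) : Matrix (PBond P j) (PBond P j) ℝ :=
  Matrix.diagonal fun b => if blockOf b.src ∈ S ∧ blockOf b.tgt ∈ S then 1 else 0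

open Classical in
/-- kernel: the entries of the cut-off. [cite: BalabanImbrieJaffe1988, (5.5.2) p.283] -/
theorem cutStar_mul_apply (S : Finset (Balaban1983to89.Site P (j + 1))) (M : Matrix (PBond P j) (PBond P j) ℝ) (b b' : PBond P j) :
    (cutStar S * M) b b' = (if blockOf b.src ∈ S ∧ blockOf b.tgt ∈ S then 1 else 0) * M b b' := by
  unfold cutStar
  rw [Matrix.diagonal_mul]

open Classical in
/-- **THE REPAIR** — what (2.10) does ensure: with the cut-off placed INSIDE the localized covariance, `Q·(C^{(k)}_{loc}Λ*) = 0` for every `C̃`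
and every union of blocks `Λ` (indeed for every right factor), by `QC^{(k)}_{loc} = 0` (`BIJ88Eq210Torus.qKer_mul_clocKer`).
[cite: BalabanImbrieJaffe1988, (2.10) p.261] -/
theorem qKer_mul_clocKer_mul (hj : j + 1 ≤ P.m + P.K) (Ct X : Matrix (PBond P j) (PBond P j) ℝ) :
    qKer P j * (clocKer (qKer P j) (qstKer P j) (qsKer (torusBlockBonds P j)) (qsstKer (torusBlockBonds P j)) Ct * X) = 0 := by
  rw [← Matrix.mul_assoc]
  have h' : qKer P j * clocKer (qKer P j) (qstKer P j) (qsKer (torusBlockBonds P j)) (qsstKer (torusBlockBonds P j)) Ct = 0 := by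
    convert qKer_mul_clocKer hj Ct using 4
  rw [h', Matrix.zero_mul]

/-! ## 2. The witness data: a straddling L-bond `⟨y, y + e₁⟩` and an interior non-tree unit bond `b₀` of `B(y)` -/

/-- the first lattice direction `e₀` (`d ≥ 2`). [folklore] -/
private def dir0 (hd : 2 ≤ P.d) : Fin P.d := ⟨0, by omega⟩

/-- the second lattice direction `e₁` (`d ≥ 2`). [folklore] -/
private def dir1 (hd : 2 ≤ P.d) : Fin P.d := ⟨1, hd⟩

/-- The offsets `(1, 0, …, 0)` inside an L-block (`L > 1`): position `1` in the direction `e₀`, the corner position elsewhere.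
[cite: BalabanImbrieJaffe1988, (5.5.2) p.283] -/
def witnessOffsets (hd : 2 ≤ P.d) : Fin P.d → Fin P.L :=
  fun κ => if κ = dir0 hd then ⟨1, P.hL.2⟩ else ⟨0, P.L_pos⟩

/-- The witness bond `b₀ = ⟨x₀, x₀ + e₁⟩`, `x₀` the site of `B(y)` with offsets `(1, 0, …, 0)`: interior to `B(y)`, in the direction `e₁`,
one step off the corner in the direction `e₀` — hence NOT on the axial tree (whose `e₁`-bonds have `e₀`-position `0`).
[cite: BalabanImbrieJaffe1988, (5.5.2) p.283] -/
def witnessBond (hd : 2 ≤ P.d) (y : Balaban1983to89.Site P (j + 1)) : PBond P j := ⟨Site.blockSite y (witnessOffsets hd), dir1 hd⟩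

/-- kernel: `e₀ ≠ e₁`. [folklore] -/
private theorem dir0_ne_dir1 (hd : 2 ≤ P.d) : dir0 (P := P) hd ≠ dir1 hd := by
  simp [dir0, dir1]

/-- kernel: the `e₁`-offset of the witness site is `0`. [folklore] -/
private theorem witnessOffsets_dir1 (hd : 2 ≤ P.d) : (witnessOffsets (P := P) hd (dir1 hd) : ℕ) = 0 := by
  simp [witnessOffsets, (dir0_ne_dir1 hd).symm]

/-- kernel: the `e₀`-offset of the witness site is `1`. [folklore] -/
private theorem witnessOffsets_dir0 (hd : 2 ≤ P.d) : (witnessOffsets (P := P) hd (dir0 hd) : ℕ) = 1 := by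
  simp [witnessOffsets]

/-- kernel: `b₀` is an INTERIOR bond of `B(y)` — both endpoints in `B(y)` (`L > 1`). [cite: BalabanImbrieJaffe1988, (5.5.2) p.283] -/
theorem blockOf_witnessBond (hj : j + 1 ≤ P.m + P.K) (hd : 2 ≤ P.d) (y : Balaban1983to89.Site P (j + 1)) :
    blockOf (witnessBond hd y).src = y ∧ blockOf (witnessBond hd y).tgt = y := by
  refine ⟨Site.blockOf_blockSite hj y _, ?_⟩
  have hlt : (witnessOffsets (P := P) hd (dir1 hd) : ℕ) + 1 < P.L := by rw [witnessOffsets_dir1]; exact P.hL.2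
  have h : (witnessBond hd y).tgt = runSite (Site.blockSite y (witnessOffsets hd)) (dir1 hd) 1 := by
    rw [runSite_succ, runSite_zero]
    rfl
  rw [h]
  exact blockOf_runSite_blockSite_of_lt hj y _ (dir1 hd) hlt

/-- kernel: `b₀` is NOT a bond of the block axial tree of record (`BIJ88RenormTransf311.IsAxialBond`: an `e₁`-bond of the tree has
`e₀`-position `0` in its block; `b₀` has `e₀`-position `1`). [cite: BalabanImbrieJaffe1988, (3.11) p.266] -/
theorem not_isAxialBond_witnessBond (hj : j + 1 ≤ P.m + P.K) (hd : 2 ≤ P.d) (y : Balaban1983to89.Site P (j + 1)) :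
    ¬ IsAxialBond (witnessBond hd y) := by
  intro h
  have h0 := h.1 (dir0 hd) (by show (⟨0, _⟩ : Fin P.d) < ⟨1, _⟩; exact Fin.mk_lt_mk.2 zero_lt_one)
  unfold inBlock at h0
  change ((Site.blockSite y (witnessOffsets hd)) (dir0 hd)).val % P.L = 0 at h0
  rw [Site.val_blockSite hj, witnessOffsets_dir0, Nat.mul_add_mod', Nat.mod_eq_of_lt P.hL.2] at h0
  exact one_ne_zero h0

open Classical in
/-- kernel: hence the matrix unit `C̃ = E_{b₀b₀}` has vanishing rows and columns at every tree bond — the axial-gauge property (2.11) asks of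
`C̃^{(k)}` (p02's hypotheses `hrow`/`hcol`) — besides range `0 ≤ ¼r(e_k)` and symmetry. [cite: BalabanImbrieJaffe1988, (2.11) p.261] -/
theorem single_witness_rows_cols (hj : j + 1 ≤ P.m + P.K) (hd : 2 ≤ P.d) (y : Balaban1983to89.Site P (j + 1)) (b : PBond P j)
    (hb : b ∈ (axialBonds : Finset (PBond P j))) (b' : PBond P j) :
    Matrix.single (witnessBond hd y) (witnessBond hd y) (1 : ℝ) b b' = 0 ∧
      Matrix.single (witnessBond hd y) (witnessBond hd y) (1 : ℝ) b' b = 0 := by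
  have hne : witnessBond hd y ≠ b := fun h => not_isAxialBond_witnessBond hj hd y (h ▸ mem_axialBonds.1 hb)
  exact ⟨Matrix.single_apply_of_row_ne hne _ _ _, Matrix.single_apply_of_col_ne _ _ hne _⟩

/-! ## 3. The witness computation -/

open Classical in
/-- kernel: the `b₀`-column of `C_loc = (1 − Q^{s*}Q)E_{b₀b₀}(1 − Q*Q^s)` for an interior `b₀` is the `b₀`-column of `1 − Q^{s*}Q`
(`Q^s` does not see interior bonds: `BIJ88Eq211Proof.qsKer_interior`). [cite: BalabanImbrieJaffe1988, (2.9) p.261] -/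
theorem clocKer_single_col (hj : j + 1 ≤ P.m + P.K) (hd : 2 ≤ P.d) (y : Balaban1983to89.Site P (j + 1)) (b : PBond P j) :
    clocKer (qKer P j) (qstKer P j) (qsKer (torusBlockBonds P j)) (qsstKer (torusBlockBonds P j))
        (Matrix.single (witnessBond hd y) (witnessBond hd y) 1) b (witnessBond hd y)
      = (1 - qsstKer (torusBlockBonds P j) * qKer P j : Matrix (PBond P j) (PBond P j) ℝ) b (witnessBond hd y) := by
  have hint : (torusBlockBonds P j).blk ((torusBlockBonds P j).src (witnessBond hd y))
      = (torusBlockBonds P j).blk ((torusBlockBonds P j).tgt (witnessBond hd y)) := by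
    show blockOf (witnessBond hd y).src = blockOf (witnessBond hd y).tgt
    rw [(blockOf_witnessBond hj hd y).1, (blockOf_witnessBond hj hd y).2]
  have h1 : ∀ b₂ : PBond P j, (1 - qstKer P j * qsKer (torusBlockBonds P j) : Matrix _ _ ℝ) b₂ (witnessBond hd y)
      = if b₂ = witnessBond hd y then 1 else 0 := by
    intro b₂
    rw [Matrix.sub_apply, Matrix.one_apply, Matrix.mul_apply,
      Finset.sum_eq_zero fun c _ => by rw [qsKer_interior (torusBlockBonds P j) hint c, mul_zero], sub_zero]
  unfold clocKer
  rw [Matrix.mul_apply]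
  simp_rw [h1, mul_ite, mul_one, mul_zero, Finset.sum_ite_eq', Finset.mem_univ, if_true]
  rw [Matrix.mul_single_apply_same, mul_one]

open Classical in
/-- **THE WITNESS.**  For every union of L-blocks `Λ = ⋃_{y∈S}B(y)` and every L-bond `c₀ = ⟨y, y + e₁⟩` leaving `Λ` (`y ∈ S`, `y + e₁ ∉ S`),
with `C̃ = E_{b₀b₀}`: `(Q·Λ*·C_loc)(c₀, b₀) = L^{−(d+1)}`.  (The only corrections `−Q^{s*}Qδ_{b₀}` to the column `δ_{b₀}` live on the surface
bonds of `c₀` — deleted by `Λ*` — and of `⟨y − e₁, y⟩` — invisible to the contours of `c₀`; the bare `δ_{b₀}` has multiplicity `1` in (2.13)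
for `c₀`.) [cite: BalabanImbrieJaffe1988, (5.5.2) p.283] -/
theorem cutoff_witness (hj : j + 1 ≤ P.m + P.K) (hd : 2 ≤ P.d) (S : Finset (Balaban1983to89.Site P (j + 1))) (y : Balaban1983to89.Site P (j + 1))
    (hy : y ∈ S) (hyS : y.shift (dir1 hd) ∉ S) :
    (qKer P j * (cutStar S * clocKer (qKer P j) (qstKer P j) (qsKer (torusBlockBonds P j)) (qsstKer (torusBlockBonds P j))
        (Matrix.single (witnessBond hd y) (witnessBond hd y) 1))) ⟨y, dir1 hd⟩ (witnessBond hd y)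
      = ((P.L : ℝ) ^ (P.d + 1))⁻¹ := by
  have hsrc : blockOf (witnessBond hd y).src = y := (blockOf_witnessBond hj hd y).1
  have htgt0 : blockOf (witnessBond hd y).tgt = y := (blockOf_witnessBond hj hd y).2
  rw [Matrix.mul_apply]
  simp_rw [cutStar_mul_apply, clocKer_single_col hj hd y, Matrix.sub_apply, Matrix.one_apply, mul_sub, Finset.sum_sub_distrib]
  -- first sum: the bare column `δ_{b₀}` seen by the contours of `c₀`
  have hfirst : ∑ b : PBond P j, qKer P j ⟨y, dir1 hd⟩ b * ((if blockOf b.src ∈ S ∧ blockOf b.tgt ∈ S then (1 : ℝ) else 0) *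
      (if b = witnessBond hd y then 1 else 0)) = ((P.L : ℝ) ^ (P.d + 1))⁻¹ := by
    rw [Finset.sum_eq_single (witnessBond hd y)]
    · have hin : blockOf (witnessBond hd y).src ∈ S ∧ blockOf (witnessBond hd y).tgt ∈ S := by
        rw [hsrc, htgt0]; exact ⟨hy, hy⟩
      rw [if_pos rfl, if_pos hin, mul_one, mul_one]
      show ((P.L : ℝ) ^ (P.d + 1))⁻¹ * (runCount (⟨y, dir1 hd⟩ : PBond P (j + 1)) (witnessBond hd y) : ℝ) = _
      rw [witnessBond, runCount_blockSite hj y (witnessOffsets hd) (dir1 hd) ⟨y, dir1 hd⟩, if_pos rfl, witnessOffsets_dir1]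
      simp
    · intro b _ hne
      rw [if_neg hne, mul_zero, mul_zero]
    · intro h
      exact absurd (Finset.mem_univ _) h
  -- second sum: the surface corrections `Q^{s*}Qδ_{b₀}` are either cut off (surface of `c₀`) or not on the contours of `c₀`
  have hsecond : ∑ b : PBond P j, qKer P j ⟨y, dir1 hd⟩ b * ((if blockOf b.src ∈ S ∧ blockOf b.tgt ∈ S then (1 : ℝ) else 0) *
      (qsstKer (torusBlockBonds P j) * qKer P j) b (witnessBond hd y)) = 0 := by
    refine Finset.sum_eq_zero fun b _ => ?_
    by_cases hb : ∃ c, b ∈ (torusBlockBonds P j).Bs c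
    · obtain ⟨c, hc⟩ := hb
      by_cases hcc : (⟨y, dir1 hd⟩ : PBond P (j + 1)) = c
      · -- `b` is a surface bond of `c₀`: its far endpoint lies in `B(y + e₁) ⊄ Λ`, the cut-off deletes it
        subst hcc
        have htgt : blockOf b.tgt = y.shift (dir1 hd) := ((mem_Bs_iff _ b).1 hc).2
        rw [if_neg (fun h => hyS (htgt ▸ h.2)), zero_mul, mul_zero]
      · -- `b` is a surface bond of another L-bond: not on any contour of `c₀`
        have hq : qKer P j ⟨y, dir1 hd⟩ b = 0 := by
          unfold qKer
          rw [runCount_of_mem_Bs hj hc ⟨y, dir1 hd⟩, if_neg hcc]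
          simp
        rw [hq, zero_mul]
    · -- `b` is an interior bond: `Q^{s*}` vanishes there
      push Not at hb
      have hrow : (qsstKer (torusBlockBonds P j) * qKer P j) b (witnessBond hd y) = 0 := by
        rw [Matrix.mul_apply]
        exact Finset.sum_eq_zero fun c _ => by simp [qsstKer, hb c]
      rw [hrow, mul_zero, mul_zero]
  rw [hfirst, hsecond, sub_zero]

open Classical in
/-- **`QΛ*C^{(k)}_{loc} ≠ 0` with the cut-off OUTSIDE, as printed in (5.5.2)** — for every union of blocks `Λ` with an L-bond leaving it in
the direction `e₁` and the matrix unit `C̃ = E_{b₀b₀}` (interior, non-tree, range 0); whereas `QC^{(k)}_{loc} = 0` (`BIJ88Eq210Torus.qKer_mul_clocKer`)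
and `Q(C^{(k)}_{loc}Λ*) = 0` (`qKer_mul_clocKer_mul`). [cite: BalabanImbrieJaffe1988, (5.5.2) p.283] -/
theorem qKer_mul_cutStar_mul_clocKer_ne_zero (hj : j + 1 ≤ P.m + P.K) (hd : 2 ≤ P.d) (S : Finset (Balaban1983to89.Site P (j + 1)))
    (y : Balaban1983to89.Site P (j + 1)) (hy : y ∈ S) (hyS : y.shift (dir1 hd) ∉ S) :
    qKer P j * (cutStar S * clocKer (qKer P j) (qstKer P j) (qsKer (torusBlockBonds P j)) (qsstKer (torusBlockBonds P j))
        (Matrix.single (witnessBond hd y) (witnessBond hd y) 1)) ≠ 0 := by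
  intro h
  have h' := congrFun (congrFun h ⟨y, dir1 hd⟩) (witnessBond hd y)
  rw [cutoff_witness hj hd S y hy hyS, Matrix.zero_apply] at h'
  have hL : (P.L : ℝ) ≠ 0 := Nat.cast_ne_zero.mpr P.L_pos.ne'
  exact (inv_ne_zero (pow_ne_zero _ hL)) h'

open Classical in
/-- The smallest instance: `Λ` = one block `B(y)` (`S = {y}`; `y + e₁ ≠ y` on the tori), any `y`, any `d ≥ 2`: `QΛ*C^{(k)}_{loc} ≠ 0`.
[cite: BalabanImbrieJaffe1988, (5.5.2) p.283] -/
theorem qKer_mul_cutStar_singleton_ne_zero (hj : j + 1 ≤ P.m + P.K) (hd : 2 ≤ P.d) (y : Balaban1983to89.Site P (j + 1)) :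
    qKer P j * (cutStar {y} * clocKer (qKer P j) (qstKer P j) (qsKer (torusBlockBonds P j)) (qsstKer (torusBlockBonds P j))
        (Matrix.single (witnessBond hd y) (witnessBond hd y) 1)) ≠ 0 := by
  refine qKer_mul_cutStar_mul_clocKer_ne_zero hj hd {y} y (Finset.mem_singleton_self y) ?_
  rw [Finset.mem_singleton]
  intro h
  have h1 := congrFun h (dir1 hd)
  simp only [Balaban1983to89.Site.shift, Function.update_self] at h1
  exact one_ne_zero (add_eq_left.1 h1)

/-! ## 4. Ring-level form (the dictionary of `BIJ88Eq211Proof` §3 / `BIJ88Eq210Torus` §3) -/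

open Classical in
/-- In the ring of block matrices on `T₁-bonds ⊕ L-bonds` (p02's `embLU`/`embUU`): `Q·Λ*·C_loc ≠ 0` for the witness data — so the hypothesis
`Q * Λ4 * Cloc = 0` of the typed reading `BIJ88Sect5StatementsPart3.Q_transl552` is not available from (2.10)–(2.11) for the printed position of
the cut-off. [cite: BalabanImbrieJaffe1988, (5.5.2) p.283] -/
theorem emb_witness_ne_zero (hj : j + 1 ≤ P.m + P.K) (hd : 2 ≤ P.d) (S : Finset (Balaban1983to89.Site P (j + 1))) (y : Balaban1983to89.Site P (j + 1))
    (hy : y ∈ S) (hyS : y.shift (dir1 hd) ∉ S) :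
    embLU (qKer P j) * embUU (cutStar S) *
        embUU (clocKer (qKer P j) (qstKer P j) (qsKer (torusBlockBonds P j)) (qsstKer (torusBlockBonds P j))
          (Matrix.single (witnessBond hd y) (witnessBond hd y) 1))
      ≠ (0 : Matrix (PBond P j ⊕ PBond P (j + 1)) (PBond P j ⊕ PBond P (j + 1)) ℝ) := by
  intro h
  have hblock : ∀ (q : Matrix (PBond P (j + 1)) (PBond P j) ℝ) (X Y : Matrix (PBond P j) (PBond P j) ℝ),
      embLU q * embUU X * embUU Y = Matrix.fromBlocks (0 : Matrix (PBond P j) (PBond P j) ℝ) 0 (q * (X * Y))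
        (0 : Matrix (PBond P (j + 1)) (PBond P (j + 1)) ℝ) := by
    intro q X Y
    rw [Matrix.mul_assoc]
    have hXY : embUU X * embUU Y = (embUU (X * Y) : Matrix (PBond P j ⊕ PBond P (j + 1)) (PBond P j ⊕ PBond P (j + 1)) ℝ) := by
      simp [embUU, Matrix.fromBlocks_multiply]
    rw [hXY, embLU_mul_embUU]
  rw [hblock] at h
  have h21 := congrArg Matrix.toBlocks₂₁ h
  rw [Matrix.toBlocks_fromBlocks₂₁] at h21
  have h0 : (0 : Matrix (PBond P j ⊕ PBond P (j + 1)) (PBond P j ⊕ PBond P (j + 1)) ℝ).toBlocks₂₁ = 0 := rfl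
  rw [h0] at h21
  exact qKer_mul_cutStar_mul_clocKer_ne_zero hj hd S y hy hyS h21

end Literature.MathematicalPhysics.QuantumFieldTheory.BalabanImbrieJaffe1984to88.BIJ88Eq552CutoffWitness
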